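import Summits.BirchSwinnertonDyer.BirchSwinnertonDyer.Theorems.BiquadraticEisensteinDescentHeegnerTwistCouplingInSupplyIndefinitePinCorner
import Literature.NumberTheory.EllipticCurves.HeathBrown1994.CongruentTwoSelmerMonskyDoorsDeuringFree
import HarnessLib

set_option linter.dupNamespace false -- `Summit.BirchSwinnertonDyer.BirchSwinnertonDyer.Theorems.…` (summit = sub)
set_option autoImplicit false

/-!
# Crux `HeegnerTwistCouplingInSupply` (stmt-BirchSwinnertonDyer-21381) — the congruent corner `W = E_{2p}` (every prime
# `p ≡ 3 (mod 4)`, `p ≥ 7`) modulo FOUR named facts: the Deuring–Hecke leaf is discharged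

Route `BiquadraticEisensteinDescent` (cell `pub/bsd-wall`, width seat `bsd-wall-cm-bed-w4` g12; `--supports` 21381, helper).
Every corner theorem of this layer (g10 p644288/p645024/p645829, g11 p649700, this seat's p652497) was stated modulo FIVE named
facts: Modularity `exists_isNewformOf` (only for `N(E_{2p}) = 64p²` / `N(E_p) = 32p²`), Monsky's matrix theorem, Burungale–Tian's
rank-zero `2`-converse, the Deuring–Hecke continuation `hasEntireLFunction_of_j_mem_maximalCMJInvariants`, Burungale–Flach. The
fourth is used ONLY to know that `L(E_n, s)` is entire, and for `E_n : y² = x³ − n²x` that is the tree's THEOREM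
`hasEntireLFunction_congruentNumberCurve_holds` (Ireland–Rosen point count + Hecke theta continuation over `ℤ[i]`, proved); the
Literature doors `HeathBrown1994.bsdTriple_of_monsky_of_BT_BF_even_congruent / _odd_congruent` (p653095, this seat) take the three
remaining descent facts. This file re-threads the `E_{2p}` corner through them:

* §1 `analyticRank_eq_zero_of_det_even_fourFacts` / `…_odd_fourFacts` — the three-term journal doors WITHOUT Deuring–Hecke;
* §2 the `L`-halves of cells A / B and of the dual-pin corner;
* §3 ★ `cruxOnE2pCorner_of_four_facts` — **for EVERY prime `p ≡ 3 (mod 4)`, `p ≥ 7`: a Heegner field `K′` of `N(E_{2p})` with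
  `4 < |d_{K′}|`, `L(E_{2p}^{(d_{K′})}, 1) ≠ 0`, `h(K′) < p`, `p ∤ h(K′)` — modulo Modularity (conductor only) + Monsky (even) +
  Burungale–Tian + Burungale–Flach**, i.e. g11's `cruxOnE2pCorner_of_facts` with one named fact fewer.

HONEST FRAMING: typed sub-corner rung of the crux's CONCLUSION on one CM family; the crux (all CM `W` of analytic rank one; residual
C⁺) is untouched; BSD is not proved by any of this. THEOREMS ONLY. Supports stmt-BirchSwinnertonDyer-21381.
-/

namespace Summit.BirchSwinnertonDyer.BirchSwinnertonDyer.Theorems.BiquadraticEisensteinDescentHeegnerTwistCouplingInSupplyCornersE2pFourFacts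

open Literature.NumberTheory.EllipticCurves Literature.NumberTheory.EllipticCurves.HeathBrown1994
  Literature.NumberTheory.EllipticCurves.HeathBrown1994.Families
  Literature.NumberTheory.QuadraticFields Literature.NumberTheory.QuadraticFields.Quadratic
  Summit.BirchSwinnertonDyer.BirchSwinnertonDyer.Theorems.BiquadraticEisensteinDescentHeegnerTwistCouplingInSupplyThreeSquaresPinDual
  Summit.BirchSwinnertonDyer.BirchSwinnertonDyer.Theorems.BiquadraticEisensteinDescentHeegnerTwistCouplingInSupplyMonskyCells
  Summit.BirchSwinnertonDyer.BirchSwinnertonDyer.Theorems.BiquadraticEisensteinDescentHeegnerTwistCouplingInSupplyThreeSquaresPinRankZero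
  Summit.BirchSwinnertonDyer.BirchSwinnertonDyer.Theorems.BiquadraticEisensteinDescentHeegnerTwistCouplingInSupplySizeIndivisibleSharp
  Summit.BirchSwinnertonDyer.BirchSwinnertonDyer.Theorems.BiquadraticEisensteinDescentHeegnerTwistCouplingInSupplyThreeSquaresPinCorner
  Summit.BirchSwinnertonDyer.BirchSwinnertonDyer.Theorems.BiquadraticEisensteinDescentHeegnerTwistCouplingInSupplyThreeSquaresPinCornerDual
  Summit.BirchSwinnertonDyer.BirchSwinnertonDyer.Theorems.BiquadraticEisensteinDescentHeegnerTwistCouplingInSupplyIndefinitePin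
  Summit.BirchSwinnertonDyer.BirchSwinnertonDyer.Theorems.BiquadraticEisensteinDescentHeegnerTwistCouplingInSupplyPartnerTables
  Summit.BirchSwinnertonDyer.BirchSwinnertonDyer.Theorems.BiquadraticEisensteinDescentHeegnerTwistCouplingInSupplyIndefinitePinWitness
  Summit.BirchSwinnertonDyer.BirchSwinnertonDyer.Theorems.BiquadraticEisensteinDescentHeegnerTwistCouplingInSupplyIndefinitePinCorner

/-! ## §1 The three-term journal doors without Deuring–Hecke -/

/-- **Even door, three facts**: Monsky (even) + `det M(a, b, c) = 1` + Burungale–Tian + Burungale–Flach ⟹ `E_{2a(bc)}` has the BSD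
triple, analytic rank `0` and `L(E_{2abc}, 1) ≠ 0`; the continuation of `L(E_n, s)` is the tree's theorem.
[cite: HeathBrown1994SelmerCongruentII, Appendix (Monsky), typescript p. 41 L20–L36] [cite: BurungaleTian2026, Thm. 1.1]
[cite: BurungaleFlach2024, Thm. 1.1 and Cor. 2] [cite: KoblitzECMF1993, Ch. II §5, Theorem (p. 84)] -/
theorem analyticRank_eq_zero_of_det_even_fourFacts {a b c : ℕ} (hM : monsky_card_selmerGroup_two_even)
    (hBT : burungaleTian_analyticRank_eq_zero_of_selmerCorank_eq_zero_of_hasCM) (hBF : bsdTriple_of_hasCM_of_L_one_ne_zero)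
    (ha : a.Prime) (hb : b.Prime) (hc : c.Prime) (ha2 : a % 2 = 1) (hb2 : b % 2 = 1) (hc2 : c % 2 = 1)
    (hab : a ≠ b) (hac : a ≠ c) (hbc : b ≠ c) (hdet : (monskyMatrixEven ![a, b, c]).det = 1) :
    Squarefree (2 * a * (b * c)) ∧ (congruentNumberCurve (2 * a * (b * c))).BSDTriple ∧
      (congruentNumberCurve (2 * a * (b * c))).analyticRank = 0 ∧
      (congruentNumberCurve (2 * a * (b * c))).entireLFunction 1 ≠ 0 := by
  have hprime : ∀ i, ((![a, b, c] : Fin 3 → ℕ) i).Prime := by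
    intro i
    fin_cases i <;> assumption
  have hodd : ∀ i, Odd ((![a, b, c] : Fin 3 → ℕ) i) := by
    intro i
    fin_cases i
    · exact Nat.odd_iff.mpr ha2
    · exact Nat.odd_iff.mpr hb2
    · exact Nat.odd_iff.mpr hc2
  have hinj := vecTriple_injective hab hac hbc
  have h := bsdTriple_of_monsky_of_BT_BF_even_congruent (![a, b, c] : Fin 3 → ℕ) hM hBT hBF hprime hodd hinj hdet
  have hsq0 := squarefree_two_mul_prod_of_injective (![a, b, c] : Fin 3 → ℕ) hprime hodd hinj
  have hprod := two_mul_prod_vecTriple a b c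
  rw [hprod] at hsq0
  simp only [hprod] at h
  obtain ⟨⟨hB, -, hA⟩, hL, -⟩ := h
  exact ⟨hsq0, hB, hA, hL⟩

/-- **Odd door, three facts**: Monsky (odd) + `det M(a, b, c) = 1` + Burungale–Tian + Burungale–Flach ⟹ `E_{a(bc)}` has the BSD
triple, analytic rank `0` and `L(E_{abc}, 1) ≠ 0`. [cite: HeathBrown1994SelmerCongruentII, Appendix (Monsky), typescript p. 39 L27–L33]
[cite: BurungaleTian2026, Thm. 1.1] [cite: BurungaleFlach2024, Thm. 1.1 and Cor. 2] [cite: KoblitzECMF1993, Ch. II §5, Theorem (p. 84)] -/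
theorem analyticRank_eq_zero_of_det_odd_fourFacts {a b c : ℕ} (hM : monsky_card_selmerGroup_two_odd)
    (hBT : burungaleTian_analyticRank_eq_zero_of_selmerCorank_eq_zero_of_hasCM) (hBF : bsdTriple_of_hasCM_of_L_one_ne_zero)
    (ha : a.Prime) (hb : b.Prime) (hc : c.Prime) (ha2 : a % 2 = 1) (hb2 : b % 2 = 1) (hc2 : c % 2 = 1)
    (hab : a ≠ b) (hac : a ≠ c) (hbc : b ≠ c) (hdet : (monskyMatrixOdd ![a, b, c]).det = 1) :
    Squarefree (a * (b * c)) ∧ (congruentNumberCurve (a * (b * c))).BSDTriple ∧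
      (congruentNumberCurve (a * (b * c))).analyticRank = 0 ∧
      (congruentNumberCurve (a * (b * c))).entireLFunction 1 ≠ 0 := by
  have hprime : ∀ i, ((![a, b, c] : Fin 3 → ℕ) i).Prime := by
    intro i
    fin_cases i <;> assumption
  have hodd : ∀ i, Odd ((![a, b, c] : Fin 3 → ℕ) i) := by
    intro i
    fin_cases i
    · exact Nat.odd_iff.mpr ha2
    · exact Nat.odd_iff.mpr hb2
    · exact Nat.odd_iff.mpr hc2
  have hinj := vecTriple_injective hab hac hbc
  have h := bsdTriple_of_monsky_of_BT_BF_odd_congruent (![a, b, c] : Fin 3 → ℕ) hM hBT hBF hprime hodd hinj hdet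
  have hsq0 := squarefree_prod_of_injective (![a, b, c] : Fin 3 → ℕ) hprime hinj
  have hprod := prod_vecTriple a b c
  rw [hprod] at hsq0
  simp only [hprod] at h
  obtain ⟨⟨hB, -, hA⟩, hL, -⟩ := h
  exact ⟨hsq0, hB, hA, hL⟩

/-! ## §2 `L`-halves of the `E_{2p}` cells, four facts -/

/-- Cell A with the partner `5` (`p ≡ 3 (mod 4)`, `p ≡ ±2 (mod 5)`, `q` of type `(3,+)`): `L(E_{2p·5q}, 1) ≠ 0`, four facts.
[cite: HeathBrown1994SelmerCongruentII, Appendix (Monsky), typescript p. 41 L20–L36] [cite: BurungaleTian2026, Thm. 1.1] -/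
theorem analyticRank_eq_zero_cellA_five_fourFacts (hM : monsky_card_selmerGroup_two_even)
    (hBT : burungaleTian_analyticRank_eq_zero_of_selmerCorank_eq_zero_of_hasCM) (hBF : bsdTriple_of_hasCM_of_L_one_ne_zero)
    {p q : ℕ} (hp : p.Prime) (hp4 : p % 4 = 3) (hp5 : p % 5 = 2 ∨ p % 5 = 3) (hq : q.Prime) (hq8 : q % 8 = 3)
    (hJ : jacobiSym (q : ℤ) p = 1) :
    (congruentNumberCurve (2 * p * (q * 5))).entireLFunction 1 ≠ 0 := by
  have h5p : jacobiSym ((5 : ℕ) : ℤ) p = -1 := by exact_mod_cast jacobiSym_five_eq_neg_one (p := p) (by omega) hp5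
  have hdet := det_monskyMatrixEven_cellA (p := p) hq Nat.prime_five hp4 hq8 (by norm_num) hJ h5p
  have hqp : q ≠ p := ne_of_jacobiSym_ne_zero hp (by rw [hJ]; norm_num)
  exact (analyticRank_eq_zero_of_det_even_fourFacts hM hBT hBF hp hq Nat.prime_five (by omega) (by omega) (by norm_num)
    (Ne.symm hqp) (by rintro rfl; omega) (by rintro rfl; omega) hdet).2.2.2

/-- Cell B with the partner `5` (`p ≡ 3 (mod 4)`, `p ≡ ±1 (mod 5)`, `q` of type `(3,−)`): `L(E_{2p·5q}, 1) ≠ 0`, four facts.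
[cite: HeathBrown1994SelmerCongruentII, Appendix (Monsky), typescript p. 41 L20–L36] [cite: BurungaleTian2026, Thm. 1.1] -/
theorem analyticRank_eq_zero_cellB_five_fourFacts (hM : monsky_card_selmerGroup_two_even)
    (hBT : burungaleTian_analyticRank_eq_zero_of_selmerCorank_eq_zero_of_hasCM) (hBF : bsdTriple_of_hasCM_of_L_one_ne_zero)
    {p q : ℕ} (hp : p.Prime) (hp4 : p % 4 = 3) (hp5 : p % 5 = 1 ∨ p % 5 = 4) (hq : q.Prime) (hq8 : q % 8 = 3)
    (hJ : jacobiSym (q : ℤ) p = -1) :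
    (congruentNumberCurve (2 * p * (q * 5))).entireLFunction 1 ≠ 0 := by
  have hdet := det_monskyMatrixEven_dualPin_five hp4 hp5 hq hq8 hJ
  have hqp : q ≠ p := ne_of_jacobiSym_ne_zero hp (by rw [hJ]; norm_num)
  exact (analyticRank_eq_zero_of_det_even_fourFacts hM hBT hBF hp hq Nat.prime_five (by omega) (by omega) (by norm_num)
    (Ne.symm hqp) (by rintro rfl; omega) (by rintro rfl; omega) hdet).2.2.2

/-! ## §3 The corner `W = E_{2p}`, four facts -/

/-- The common field-and-twist assembly for `E_{2p}` with `K′ = ℚ(√−5q)`: from `(−5q/p) = +1`, a class-number certificate and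
`L(E_{2p·5q}, 1) ≠ 0` to the corner conclusion (Modularity enters only through `N(E_{2p}) = 64p²`).
[cite: Marcus2018, Ch. 3 Thm. 25] [cite: KoblitzECMF1993, Ch. II §5, Theorem (p. 84)] -/
theorem corner_two_p_of_partner_five (hmod : ModularForms.exists_isNewformOf) {p q : ℕ} [Fact p.Prime]
    [(congruentNumberCurve (2 * p)).IsElliptic] [(congruentNumberCurve (2 * p)).IsGloballyMinimal]
    [NeZero ((congruentNumberCurve (2 * p)).conductorNorm ℤ)] (hp2 : p % 2 = 1) (hq : q.Prime) (hq8 : q % 8 = 3)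
    (hJ5 : jacobiSym (-(5 * (q : ℤ))) p = 1)
    (hh : ∀ (K : Type) [Field K] [NumberField K], IsImaginaryQuadratic K →
      NumberField.discr K = -((5 * q : ℕ) : ℤ) → NumberField.classNumber K < p)
    (hL : (congruentNumberCurve (2 * p * (q * 5))).entireLFunction 1 ≠ 0) :
    ∃ (K : Type) (_ : Field K) (_ : NumberField K),
      IsImaginaryQuadratic K ∧ 4 < (NumberField.discr K).natAbs ∧
      SatisfiesHeegnerHypothesis ((congruentNumberCurve (2 * p)).conductorNorm ℤ) K ∧
      ((congruentNumberCurve (2 * p)).quadraticTwist (NumberField.discr K : ℚ)).entireLFunction 1 ≠ 0 ∧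
      NumberField.classNumber K < p ∧ ¬ p ∣ NumberField.classNumber K := by
  have hp : p.Prime := Fact.out
  have hsq2p : Squarefree (2 * p) := by
    rw [Nat.squarefree_mul ((Nat.coprime_primes Nat.prime_two hp).mpr (by omega))]
    exact ⟨Nat.prime_two.squarefree, hp.squarefree⟩
  have hN : (congruentNumberCurve (2 * p)).conductorNorm ℤ = 64 * p ^ 2 :=
    (rootNumber_eq_and_conductorNorm_congruentNumberCurve_two_mul hmod hsq2p).2
  obtain ⟨K, iF, iN, hK, hdK, hH', hcl⟩ := exists_witnessField_five_of (N := (congruentNumberCurve (2 * p)).conductorNorm ℤ)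
    hq hq8 hJ5 hh (fun r hr hrN => eq_two_or_eq_of_prime_dvd_sixtyFour_mul_sq hp hr (hN ▸ hrN))
  refine ⟨K, iF, iN, hK, ?_, hH', ?_, hcl, fun hdvd =>
    absurd (Nat.le_of_dvd (NumberField.classNumber_pos K) hdvd) (not_le.mpr hcl)⟩
  · rw [hdK, Int.natAbs_neg, Int.natAbs_natCast]
    have := hq.two_le
    omega
  · rw [hdK, quadraticTwist_congruentNumberCurve, Int.natAbs_neg, Int.natAbs_natCast]
    have h55 : 2 * p * (5 * q) = 2 * p * (q * 5) := by ring
    rw [h55]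
    exact hL

/-- ★ **THE CONGRUENT CORNER `W = E_{2p}` IN FULL, FOUR NAMED FACTS: every prime `p ≡ 3 (mod 4)`, `p ≥ 7`** — modulo Modularity
(`exists_isNewformOf`, for `N(E_{2p}) = 64p²` only) + Monsky (even) + Burungale–Tian + Burungale–Flach there is a Heegner field `K′`
of `N(E_{2p})` with `4 < |d_{K′}|`, `L(E_{2p}^{(d_{K′})}, 1) ≠ 0`, `h(K′) < p` and `p ∤ h(K′)` (g11's `cruxOnE2pCorner_of_facts`
without the Deuring–Hecke leaf). Cells: A (`p ≡ ±2 (5)`: `(3,+)` pin/table, partner `5`), B (`p ≡ ±1 (5)`, `p ≡ 3 (8)`: `(3,−)`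
pin/table), dual pin (`p ≡ ±1 (5)`, `p ≡ 7 (8)`: `ℓ′ < p`), all with `K′ = ℚ(√−5q)`.
[cite: HeathBrown1994SelmerCongruentII, Appendix (Monsky), typescript p. 41 L20–L36] [cite: BurungaleTian2026, Thm. 1.1]
[cite: BurungaleFlach2024, Thm. 1.1 and Cor. 2] [cite: KoblitzECMF1993, Ch. II §5, Theorem (p. 84)] -/
theorem cruxOnE2pCorner_of_four_facts (hmod : ModularForms.exists_isNewformOf) (hM : monsky_card_selmerGroup_two_even)
    (hBT : burungaleTian_analyticRank_eq_zero_of_selmerCorank_eq_zero_of_hasCM) (hBF : bsdTriple_of_hasCM_of_L_one_ne_zero) :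
    ∀ (p : ℕ) [Fact p.Prime] [(congruentNumberCurve (2 * p)).IsElliptic]
      [(congruentNumberCurve (2 * p)).IsGloballyMinimal]
      [NeZero ((congruentNumberCurve (2 * p)).conductorNorm ℤ)],
      p % 4 = 3 → 7 ≤ p →
      ∃ (K : Type) (_ : Field K) (_ : NumberField K),
        IsImaginaryQuadratic K ∧ 4 < (NumberField.discr K).natAbs ∧
        SatisfiesHeegnerHypothesis ((congruentNumberCurve (2 * p)).conductorNorm ℤ) K ∧
        ((congruentNumberCurve (2 * p)).quadraticTwist (NumberField.discr K : ℚ)).entireLFunction 1 ≠ 0 ∧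
        NumberField.classNumber K < p ∧ ¬ p ∣ NumberField.classNumber K := by
  intro p hpF _ _ _ hp4 h7
  have hp : p.Prime := hpF.out
  have hp5 : (p % 5 = 2 ∨ p % 5 = 3) ∨ (p % 5 = 1 ∨ p % 5 = 4) := by
    have : p % 5 ≠ 0 := fun h0 => by
      have : 5 ∣ p := Nat.dvd_of_mod_eq_zero h0
      rcases (Nat.prime_dvd_prime_iff_eq Nat.prime_five hp).mp this with h
      omega
    omega
  rcases hp5 with hA | hB
  · -- cell A
    obtain ⟨q, hq, hq8, hJ, hh⟩ := exists_threePlus_classNumber_lt hp hp4 hA h7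
    exact corner_two_p_of_partner_five hmod (by omega) hq hq8 (jacobiSym_neg_five_mul_cellA hp4 hA hJ) hh
      (analyticRank_eq_zero_cellA_five_fourFacts hM hBT hBF hp hp4 hA hq hq8 hJ)
  · rcases (show p % 8 = 3 ∨ p % 8 = 7 by omega) with h3 | h7'
    · -- cell B, `p ≡ 3 (mod 8)`
      obtain ⟨q, hq, hq8, hJ, hh⟩ := exists_threeMinus_classNumber_lt hp h3 hB
      exact corner_two_p_of_partner_five hmod (by omega) hq hq8 (jacobiSym_neg_five_mul_cellB hp4 hB hJ) hh
        (analyticRank_eq_zero_cellB_five_fourFacts hM hBT hBF hp hp4 hB hq hq8 hJ)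
    · -- dual pin, `p ≡ 7 (mod 8)`: `ℓ′ < p`, so `5ℓ′ < 5p < 6p` and the size table/lever of p645024 applies
      obtain ⟨ℓ, hℓ, hlt, hℓ8, hJ, -, hJ5, hsz⟩ := exists_dualPin_heegnerData hp h7' hB
      have h11 : 11 ≤ p := by omega
      refine corner_two_p_of_partner_five hmod (by omega) hℓ hℓ8 hJ5 (fun K _ _ hK hdK => ?_)
        (analyticRank_eq_zero_cellB_five_fourFacts hM hBT hBF hp hp4 hB hℓ hℓ8 hJ)
      refine classNumber_lt_of_natAbs_discr_lt_six_mul hK ?_ h11 ?_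
      · rw [hdK, Int.natAbs_neg, Int.natAbs_natCast]
        have := hℓ.two_le
        omega
      · rw [hdK, Int.natAbs_neg, Int.natAbs_natCast]
        omega

end Summit.BirchSwinnertonDyer.BirchSwinnertonDyer.Theorems.BiquadraticEisensteinDescentHeegnerTwistCouplingInSupplyCornersE2pFourFacts
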